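/-
Width seat `ym-line-cbag-p1-w3` (prover-ym-line-cbag-p1-w3-g2-0), route `ColdBoxAllGroups`, crux `BulkAllGroups`
(stmt-QuantumFields-22255), line `dlr-chessboard-G` (lead `ym-line-cbag-p2`, skeleton `Cruxes/BulkAllGroups/Lines/birth.lean` v4):
the COMPETITOR of a crude-good datum for every compact gauge group — G-port of `…BulkDominatesColdBoxWDatumCompetitor`.
-/
import Summits.QuantumFields.YangMills.Theorems.ColdBoxAllGroupsBulkAllGroupsLinearisedDatumEnergyG
import Summits.QuantumFields.YangMills.Theorems.ColdBoxAllGroupsBulkAllGroupsSmallLinksDatumG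
import Summits.QuantumFields.YangMills.Theorems.WeakCouplingRatesBulkDominatesColdBoxWDatumCompetitor

/-!
# Crux `BulkAllGroups` (stmt-QuantumFields-22255), interfaces `KernelMeanExpansionG` / `KernelCovExpansionG`: the COMPETITOR of a crude-good
# datum — a small forest-gauged gauge copy on the enlarged box, its exponential coordinates, and the energy bound
# `Σ_c M_{a_c}(a_c) ≤ #P·(2β^{2δ−1} + 380 m³)`, every compact `G` presented in `U(N)`

G-port of `Theorems/WeakCouplingRatesBulkDominatesColdBoxWDatumCompetitor.lean` (`SU(2)`, gnomonic chart).  For a faithful continuous unitary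
`ρ : G →* U(N)` (`N ≥ 1`) and a datum `ω` crude-good at scale `β^{2δ−1}` for the box `H` (`CrudeGoodG ρ β δ H ω`: every plaquette based in the
corona range `[−1, 2H+1]⁴` costs `≤ β^{2δ−1}`):

* §1 `cost_le_half_card_mul_opDist1_sq` — `N − Re tr ρ(g) ≤ (N/2)‖ρ g − 1‖²_op`; `opDist1_plaquette_leG` — a plaquette holonomy is within
  `ℓ₁+ℓ₂+ℓ₃+ℓ₄` of `1` (`ℓ = ‖ρ(·) − 1‖_op`); **`plaqCostAt_le_of_opDist1_links_leG`** — links within `r` of `1` ⇒ every plaquette costs `≤ 8N r²`;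
* §2 `opDist1_trunc_leG` — links of the truncation `glueWith E (U|_E) 1` are within `r` of `1` if those of `U` on `E` are;
  **`forestFix_trunc_links_leG`** — then EVERY link of `W = forestFix H (glueWith E (U|_E) 1)` is within
  `m₀ = (12H²+2H+1)(√(2·8N r²) + 4r)` of `1` (the lead's `opDist1_le_uniform_of_exterior_leG`: the forest gauge does not move exterior links,
  kills the forest, and keeps plaquette costs); `plaqCostAt_forestFix_trunc_gauge_eqG` — on the plaquettes of the enlarged box the costs of the
  forest-gauged truncated gauge copy of `ω` ARE those of `ω`;
* §3 **`exists_datum_chartCoords_energy_leG`** — with the gauge `g` of the lead's `exists_gauge_opDist1_le_of_crudeGoodG` (links of `ω^g` on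
  `E = boxEdgesAt dirCorner (2H+3)` within `r₀ = 4(2H+3)√(2β^{2δ−1})`), and PROVIDED `m₀ ≤ r₁` (the operator-norm chart radius of
  `exists_expChartRadius_opDist1`) and `m := 2√N·m₀ ≤ 1/4`: there are exponential coordinates `a : edges → ℝ^D` of
  `W = forestFix H (glueWith E ((ω^g)|_E) 1)` on ALL of `ℤ⁴` — `W e = expChart ρ (a e)` and `‖a e‖ ≤ m` for every edge `e`, `a e = 0` wherever
  `W e = 1` (so off `E`, and on the temporal forest) — whose `D` one-colour Maxwell energies (datum = free values = the colour components) obey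
  `Σ_c M_{a_c}(a_c) ≤ #P·(2β^{2δ−1} + 380 m³)`, `P` = plaquette labels of the enlarged box (`sum_formM_chartCoords_le`).  In the line's bookkeeping
  `m ≍ √N·H³β^{δ−1/2}` and `380 m³ ≤ β^{2δ−1}` eventually (`…DatumCompetitorEventuallyG`).

No new definition; standard axioms.  NOT a claim about the mass gap; the Yang–Mills mass gap is NOT proved by any of this (rung-level support of
R2xi-G `XiPow`, RECORD label).
-/

set_option autoImplicit false

noncomputable section

open Finset
open scoped Matrix.Norms.L2Operator
open Literature.Probability.LatticeModels Literature.MathematicalPhysics Literature.MathematicalPhysics.QuantumLattice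
open Literature.MathematicalPhysics.QuantumFieldTheory Literature.MathematicalPhysics.QuantumFieldTheory.AxialGauge
open Literature.MathematicalPhysics.QuantumFieldTheory.LatticeMaxwell
open Literature.MathematicalPhysics.QuantumFieldTheory.Balaban1983to89 Literature.MathematicalPhysics.QuantumFieldTheory.Balaban1983to89.UnitaryModel
open Summit.QuantumFields.YangMills.Theorems.WeakCouplingRates
open Summit.QuantumFields.YangMills.Theorems.FreeEnergyLogCoefficient

namespace Summit.QuantumFields.YangMills.Theorems.ColdBoxAllGroups

variable {N : ℕ} [NeZero N] {G : Type*} [Group G]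
variable (ρ : G →* Matrix (Fin N) (Fin N) ℂ) (hρu : ∀ g, ρ g ∈ Matrix.unitaryGroup (Fin N) ℂ)

/-! ## §1 Operator-norm link lengths control plaquette costs -/

include hρu in
/-- `N − Re tr ρ(g) ≤ (N/2)·‖ρ g − 1‖²_op` for unitary `ρ g` (Balaban's `2[1 − Re tr/N] ≤ ‖· − 1‖²_op`). -/
theorem cost_le_half_card_mul_opDist1_sq (g : G) : (N : ℝ) - (ρ g).trace.re ≤ (N : ℝ) / 2 * opDist1 (ρ g) ^ 2 := by
  have hN : (0 : ℝ) < N := by exact_mod_cast Nat.pos_of_ne_zero (NeZero.ne N)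
  have h2 := MatrixNorms.two_mul_one_sub_nReTr_le_opDist1_sq (n := Fin N) (hρu g)
  simp only [UnitaryModel.nReTr, Fintype.card_fin] at h2
  have h3 : 2 * (1 - (ρ g).trace.re / (N : ℝ)) = 2 * ((N : ℝ) - (ρ g).trace.re) / N := by field_simp
  rw [h3, div_le_iff₀ hN] at h2
  nlinarith

include hρu in
/-- A plaquette holonomy is within `ℓ₁ + ℓ₂ + ℓ₃ + ℓ₄` of `1` (operator-norm lengths of its four links along `ρ`). -/
theorem opDist1_plaquette_leG (U : LGConfig 4 G) (x : Site 4) (i j : Fin 4) :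
    opDist1 (ρ (plaquetteHolonomyZd U x i j)) ≤
      opDist1 (ρ (U (x, i))) + opDist1 (ρ (U (x + Pi.single i 1, j))) + opDist1 (ρ (U (x + Pi.single j 1, i))) + opDist1 (ρ (U (x, j))) := by
  unfold plaquetteHolonomyZd
  calc opDist1 (ρ (U (x, i) * U (x + Pi.single i 1, j) * (U (x + Pi.single j 1, i))⁻¹ * (U (x, j))⁻¹))
      ≤ opDist1 (ρ (U (x, i) * U (x + Pi.single i 1, j) * (U (x + Pi.single j 1, i))⁻¹)) + opDist1 (ρ (U (x, j))⁻¹) :=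
        opDist1_map_mul_le ρ hρu _ _
    _ ≤ (opDist1 (ρ (U (x, i) * U (x + Pi.single i 1, j))) + opDist1 (ρ (U (x + Pi.single j 1, i))⁻¹)) + opDist1 (ρ (U (x, j))⁻¹) := by
        gcongr; exact opDist1_map_mul_le ρ hρu _ _
    _ ≤ ((opDist1 (ρ (U (x, i))) + opDist1 (ρ (U (x + Pi.single i 1, j)))) + opDist1 (ρ (U (x + Pi.single j 1, i))⁻¹)) +
          opDist1 (ρ (U (x, j))⁻¹) := by
        gcongr; exact opDist1_map_mul_le ρ hρu _ _
    _ = _ := by rw [opDist1_map_inv ρ hρu, opDist1_map_inv ρ hρu]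

include hρu in
/-- **Small links ⇒ small plaquettes, any compact `G` in `U(N)`**: if every link is within `r ≥ 0` of `1` in operator norm, every plaquette
costs `N − Re tr ρ(U_p) ≤ 8N r²` (`‖ρ U_p − 1‖_op ≤ 4r`, cost `≤ (N/2)(4r)²`; `r ≥ 0` automatically). -/
theorem plaqCostAt_le_of_opDist1_links_leG (U : LGConfig 4 G) {r : ℝ} (hU : ∀ e, opDist1 (ρ (U e)) ≤ r)
    (x : Site 4) (i j : Fin 4) : plaqCostAt ρ x i j U ≤ 8 * N * r ^ 2 := by
  have h4 : opDist1 (ρ (plaquetteHolonomyZd U x i j)) ≤ 4 * r := by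
    have := opDist1_plaquette_leG ρ hρu U x i j
    linarith [hU (x, i), hU (x + Pi.single i 1, j), hU (x + Pi.single j 1, i), hU (x, j)]
  have h0 := opDist1_nonneg (ρ (plaquetteHolonomyZd U x i j))
  have hN : (0 : ℝ) ≤ N := Nat.cast_nonneg N
  have hc := cost_le_half_card_mul_opDist1_sq ρ hρu (plaquetteHolonomyZd U x i j)
  have hsq : opDist1 (ρ (plaquetteHolonomyZd U x i j)) ^ 2 ≤ (4 * r) ^ 2 := pow_le_pow_left₀ h0 h4 2
  calc plaqCostAt ρ x i j U = (N : ℝ) - (ρ (plaquetteHolonomyZd U x i j)).trace.re := rfl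
    _ ≤ (N : ℝ) / 2 * opDist1 (ρ (plaquetteHolonomyZd U x i j)) ^ 2 := hc
    _ ≤ (N : ℝ) / 2 * (4 * r) ^ 2 := mul_le_mul_of_nonneg_left hsq (by positivity)
    _ = 8 * N * r ^ 2 := by ring

/-! ## §2 The truncated gauge copy and its forest gauge: link and plaquette bounds -/

variable {H : ℕ}

omit [NeZero N] in
/-- Links of the truncation `glueWith E (U|_E) 1` are within `r` of `1` if those of `U` on `E` are (`r ≥ 0`). -/
theorem opDist1_trunc_leG (E : Finset (Literature.MathematicalPhysics.QuantumLattice.ZdEdge 4)) (U : LGConfig 4 G) {r : ℝ} (hr : 0 ≤ r)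
    (hU : ∀ e ∈ E, opDist1 (ρ (U e)) ≤ r) (e : Literature.MathematicalPhysics.QuantumLattice.ZdEdge 4) :
    opDist1 (ρ (glueWith E (fun e' : ↥E => U e'.1) (fun _ => 1) e)) ≤ r := by
  by_cases he : e ∈ E
  · rw [glueWith_apply_mem _ _ _ he]; exact hU e he
  · rw [glueWith_apply_not_mem _ _ _ he, map_one, UnitaryModel.opDist1_one]; exact hr

include hρu in
/-- **All links of the forest-gauged truncated copy are small**, any compact `G` in `U(N)`: for ANY finite `E`, if the links of `U` on `E` are
within `r ≥ 0` of `1`, then every link of `W = forestFix H (glueWith E (U|_E) 1)` is within `(12H²+2H+1)(√(2·8N r²) + 4r)` of `1` (`H ≥ 1`). -/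
theorem forestFix_trunc_links_leG (hH : 1 ≤ H) (E : Finset (Literature.MathematicalPhysics.QuantumLattice.ZdEdge 4)) (U : LGConfig 4 G)
    {r : ℝ} (hr : 0 ≤ r) (hU : ∀ e ∈ E, opDist1 (ρ (U e)) ≤ r) (e : Literature.MathematicalPhysics.QuantumLattice.ZdEdge 4) :
    opDist1 (ρ (forestFix H (glueWith E (fun e' : ↥E => U e'.1) (fun _ => 1)) e)) ≤
      (12 * (H : ℝ) ^ 2 + 2 * H + 1) * (Real.sqrt (2 * (8 * N * r ^ 2)) + 4 * r) := by
  set V := glueWith E (fun e' : ↥E => U e'.1) (fun _ => (1 : G)) with hV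
  have hVr : ∀ e', opDist1 (ρ (V e')) ≤ r := opDist1_trunc_leG ρ E U hr hU
  refine opDist1_le_uniform_of_exterior_leG ρ hρu hH (forestFix H V) hr ?_ ?_ ?_ e
  · intro e' he'
    rw [forestFix_apply_of_not_mem_boxEdges V he']; exact hVr e'
  · intro x hx; exact forestFix_forest V hx
  · intro x i j
    have h := plaqCostAt_le_of_opDist1_links_leG ρ hρu V hVr x i j
    rw [← plaqCostAt_forestFix ρ V x i j] at h
    exact h

omit [NeZero N] in
/-- **On the plaquettes of the enlarged box the costs of the forest-gauged truncated gauge copy are those of the datum** (gauge invariance twice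
and locality of the plaquette cost). -/
theorem plaqCostAt_forestFix_trunc_gauge_eqG (g : Site 4 → G) (ω : LGConfig 4 G) {p : Plaq 4} (hp : p ∈ plaquettesIn (halfOpenBox 4 (2 * H + 3))) :
    plaqCostAt ρ (Plaq.shift dirCorner p).1 (Plaq.shift dirCorner p).2.1 (Plaq.shift dirCorner p).2.2
        (forestFix H (glueWith (boxEdgesAt dirCorner (2 * H + 3))
          (fun e' : ↥(boxEdgesAt dirCorner (2 * H + 3)) => gaugeTransformZd g ω e'.1) (fun _ => 1))) =
      plaqCostAt ρ (Plaq.shift dirCorner p).1 (Plaq.shift dirCorner p).2.1 (Plaq.shift dirCorner p).2.2 ω := by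
  obtain ⟨e1, e2, e3, e4⟩ := shift_edges_mem_boxEdgesAt (a := dirCorner) hp
  rw [plaqCostAt_forestFix, plaqCostAt_congr ρ _ _ _ (U' := gaugeTransformZd g ω)
    (glueWith_apply_mem _ _ _ e1) (glueWith_apply_mem _ _ _ e2) (glueWith_apply_mem _ _ _ e3) (glueWith_apply_mem _ _ _ e4),
    plaqCostAt_gaugeTransformZd]

/-! ## §3 The competitor of a crude-good datum -/

variable [TopologicalSpace G] [CompactSpace G] [MeasurableSpace G]

include hρu in
/-- **The competitor of a crude-good datum, every compact `G` presented in `U(N)`.**  Let `ρ` be faithful, continuous, unitary (`N ≥ 1`), let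
`r₁ > 0` be an operator-norm chart radius (`exists_expChartRadius_opDist1`: every `g` with `‖ρ g − 1‖_op ≤ r₁` is `expChart ρ a` with
`‖a‖ ≤ 2√N‖ρ g − 1‖_op`), let `ω` be crude-good at scale `β^{2δ−1}` for the box `H ≥ 1`, and suppose the small-link radius
`m₀ = (12H²+2H+1)(√(2·8N r₀²) + 4r₀)`, `r₀ = 4(2H+3)√(2β^{2δ−1})`, satisfies `m₀ ≤ r₁` and `2√N·m₀ ≤ 1/4`.  Then there are a gauge `g` and
exponential coordinates `a : edges → ℝ^D` of the forest-gauged truncated gauge copy `W = forestFix H (glueWith E ((ω^g)|_E) 1)`,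
`E = boxEdgesAt dirCorner (2H+3)`, on all of `ℤ⁴`: `W e = expChart ρ (a e)` and `‖a e‖ ≤ 2√N·m₀` for EVERY edge, `a e = 0` wherever `W e = 1`,
and `Σ_c M_{a_c}(a_c) ≤ #P·(2β^{2δ−1} + 380(2√N·m₀)³)`, `P` = plaquette labels of the enlarged box. -/
theorem exists_datum_chartCoords_energy_leG (hρ : Continuous ρ) (hinj : Function.Injective ρ) (hH : 1 ≤ H) {β δ r₁ : ℝ}
    (hr₁ : ∀ g : G, opDist1 (ρ g) ≤ r₁ →
      ∃ a : EuclideanSpace ℝ (Fin (dimE ρ)), expChart ρ a = g ∧ ‖a‖ ≤ 2 * Real.sqrt N * opDist1 (ρ g))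
    {ω : LGConfig 4 G} (hω : CrudeGoodG ρ β δ H ω)
    (hm : (12 * (H : ℝ) ^ 2 + 2 * H + 1) *
        (Real.sqrt (2 * (8 * N * (4 * (2 * H + 3 : ℕ) * Real.sqrt (2 * β ^ (2 * δ - 1))) ^ 2)) +
          4 * (4 * (2 * H + 3 : ℕ) * Real.sqrt (2 * β ^ (2 * δ - 1)))) ≤ r₁)
    (hm' : 2 * Real.sqrt N * ((12 * (H : ℝ) ^ 2 + 2 * H + 1) *
        (Real.sqrt (2 * (8 * N * (4 * (2 * H + 3 : ℕ) * Real.sqrt (2 * β ^ (2 * δ - 1))) ^ 2)) +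
          4 * (4 * (2 * H + 3 : ℕ) * Real.sqrt (2 * β ^ (2 * δ - 1))))) ≤ 1 / 4) :
    ∃ (g : Site 4 → G) (a : Literature.MathematicalPhysics.QuantumLattice.ZdEdge 4 → EuclideanSpace ℝ (Fin (dimE ρ))),
      (∀ e, forestFix H (glueWith (boxEdgesAt dirCorner (2 * H + 3))
          (fun e' : ↥(boxEdgesAt dirCorner (2 * H + 3)) => gaugeTransformZd g ω e'.1) (fun _ => 1)) e = expChart ρ (a e)) ∧
      (∀ e, ‖a e‖ ≤ 2 * Real.sqrt N * ((12 * (H : ℝ) ^ 2 + 2 * H + 1) *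
          (Real.sqrt (2 * (8 * N * (4 * (2 * H + 3 : ℕ) * Real.sqrt (2 * β ^ (2 * δ - 1))) ^ 2)) +
            4 * (4 * (2 * H + 3 : ℕ) * Real.sqrt (2 * β ^ (2 * δ - 1)))))) ∧
      (∀ e, forestFix H (glueWith (boxEdgesAt dirCorner (2 * H + 3))
          (fun e' : ↥(boxEdgesAt dirCorner (2 * H + 3)) => gaugeTransformZd g ω e'.1) (fun _ => 1)) e = 1 → a e = 0) ∧
      ∑ c : Fin (dimE ρ), formM (fun e => e ∉ dirFreeEdges H) dirCorner (2 * H + 3) (fun e => a e c)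
          (fun e' : DirFree H => a e'.1.1 c) ≤
        (plaquettesIn (halfOpenBox 4 (2 * H + 3))).card *
          (2 * β ^ (2 * δ - 1) + 380 * (2 * Real.sqrt N * ((12 * (H : ℝ) ^ 2 + 2 * H + 1) *
            (Real.sqrt (2 * (8 * N * (4 * (2 * H + 3 : ℕ) * Real.sqrt (2 * β ^ (2 * δ - 1))) ^ 2)) +
              4 * (4 * (2 * H + 3 : ℕ) * Real.sqrt (2 * β ^ (2 * δ - 1)))))) ^ 3) := by
  classical
  set r₀ : ℝ := 4 * (2 * H + 3 : ℕ) * Real.sqrt (2 * β ^ (2 * δ - 1)) with hr₀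
  set m₀ : ℝ := (12 * (H : ℝ) ^ 2 + 2 * H + 1) * (Real.sqrt (2 * (8 * N * r₀ ^ 2)) + 4 * r₀) with hm₀
  set m : ℝ := 2 * Real.sqrt N * m₀ with hmdef
  have hr₀0 : 0 ≤ r₀ := by rw [hr₀]; positivity
  have hm₀0 : 0 ≤ m₀ := by rw [hm₀]; positivity
  have hmnn : 0 ≤ m := by rw [hmdef]; positivity
  set E := boxEdgesAt dirCorner (2 * H + 3) with hE
  -- the gauge copy of B4-G
  obtain ⟨g, hg⟩ := exists_gauge_opDist1_le_of_crudeGoodG ρ hρu hω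
  set ω₁ := gaugeTransformZd g ω with hω₁
  have hω₁E : ∀ e ∈ E, opDist1 (ρ (ω₁ e)) ≤ r₀ := by
    rintro ⟨x, i⟩ he
    have hmem := (mem_boxEdgesAt.1 he)
    simp only at hmem
    have h := hg (x - dirCorner) i hmem
    have hx : x - dirCorner - (fun _ => (1 : ℤ)) = x := by
      funext k; simp [dirCorner]
    rw [hx] at h
    exact h
  set W := forestFix H (glueWith E (fun e' : ↥E => ω₁ e'.1) (fun _ => 1)) with hW
  -- all links of `W` within `m₀`
  have hWm : ∀ e, opDist1 (ρ (W e)) ≤ m₀ := fun e => forestFix_trunc_links_leG ρ hρu hH E ω₁ hr₀0 hω₁E e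
  -- coordinates: `0` where `W e = 1`, chart coordinates elsewhere
  have hcoords : ∀ e, ∃ a : EuclideanSpace ℝ (Fin (dimE ρ)), expChart ρ a = W e ∧ ‖a‖ ≤ m ∧ (W e = 1 → a = 0) := by
    intro e
    by_cases h1 : W e = 1
    · exact ⟨0, by rw [h1, expChart_zero ρ hρ hinj], by rw [norm_zero]; exact hmnn, fun _ => rfl⟩
    · obtain ⟨a, ha, han⟩ := hr₁ (W e) ((hWm e).trans hm)
      refine ⟨a, ha, han.trans ?_, fun h => absurd h h1⟩
      rw [hmdef]
      exact mul_le_mul_of_nonneg_left (hWm e) (by positivity)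
  choose a ha han ha0 using hcoords
  refine ⟨g, a, fun e => (ha e).symm, fun e => han e, fun e he => ha0 e he, ?_⟩
  -- energy
  have henergy := sum_formM_chartCoords_le (H := H) ρ hρ W a hm' (fun e _ => (ha e).symm) (fun e _ => han e)
  refine henergy.trans ?_
  -- the plaquette costs of `W` on the enlarged box are those of `ω`, at most `β^{2δ-1}`
  have hcost : ∀ p ∈ plaquettesIn (halfOpenBox 4 (2 * H + 3)),
      plaqCostAt ρ (Plaq.shift dirCorner p).1 (Plaq.shift dirCorner p).2.1 (Plaq.shift dirCorner p).2.2 W ≤ β ^ (2 * δ - 1) := by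
    intro p hp
    rw [hW, hω₁, plaqCostAt_forestFix_trunc_gauge_eqG ρ g ω hp]
    have hij : (Plaq.shift dirCorner p).2.1 < (Plaq.shift dirCorner p).2.2 := (Plaq.mem_plaquettesIn.1 hp).2.1
    exact hω (Plaq.shift dirCorner p).1 (shift_fst_mem_corona hp) _ _ hij
  have hsum : ∑ p ∈ plaquettesIn (halfOpenBox 4 (2 * H + 3)),
      plaqCostAt ρ (Plaq.shift dirCorner p).1 (Plaq.shift dirCorner p).2.1 (Plaq.shift dirCorner p).2.2 W ≤
      (plaquettesIn (halfOpenBox 4 (2 * H + 3))).card * β ^ (2 * δ - 1) := by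
    calc _ ≤ ∑ _p ∈ plaquettesIn (halfOpenBox 4 (2 * H + 3)), β ^ (2 * δ - 1) := Finset.sum_le_sum hcost
      _ = _ := by rw [Finset.sum_const, nsmul_eq_mul]
  have e380 : ((plaquettesIn (halfOpenBox 4 (2 * H + 3))).card : ℝ) * (2 * β ^ (2 * δ - 1) + 380 * m ^ 3) =
      2 * (((plaquettesIn (halfOpenBox 4 (2 * H + 3))).card : ℝ) * β ^ (2 * δ - 1)) +
        ((plaquettesIn (halfOpenBox 4 (2 * H + 3))).card : ℝ) * (380 * m ^ 3) := by ring
  rw [e380]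
  linarith [hsum]

end Summit.QuantumFields.YangMills.Theorems.ColdBoxAllGroups

end
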